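import Literature.Analysis.FluidPDE.VeryWeakLqMild
import Literature.Analysis.FluidPDE.LpMildKatoClassical
import Literature.Analysis.FluidPDE.SteadyStrainedNS
import Literature.Analysis.FluidPDE.SteadyNSLiouvilleLpDirichlet
import HarnessLib

/-!
# Very weak steady Navier–Stokes solutions on `ℝ³` in `L^p`, `3 < p < ∞`: smoothness, and the
# Liouville endgame of Chae 2010, Thm 1.4, for `p ≤ 9/2`

Analysis/FluidPDE proofs file (theorems only: no definitions, no named facts), companion of
`SteadyNSLiouvilleLpDirichlet.lean` (steady classical solutions in `L^q ∩ Ḣ¹`, `q ≤ 9/2`, vanish)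
and of `ChaeGeneralizedSelfSimilar.lean` (the named fact
`chae2010_typeII_asymptoticallySelfSimilar`, D. Chae, J. Funct. Anal. 258 (2010) 2865–2883,
Thm. 1.4 = arXiv:0711.1113, Thm. 3.1).

**What is printed.** The proof of Chae's Thm. 1.4 (held text `paper:doi-10-1016-j-jfa-2010-02-006`,
p. 6) ends: "`V̄` is a stationary solution of the Navier–Stokes equations … In the case
`V̄ ∈ Ḣ¹ ∩ L^p(ℝ³)`, we easily obtain from (1.27) that `∫ |∇V̄|² = 0`, which implies `V̄ = 0`."
The object produced by the similarity-variable limit is an `L^p` field satisfying the STATIONARY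
Navier–Stokes system in the very weak (divergence-free tested, pressure-free) sense. This file
proves the two steps that follow, at exactly that level:

* `exists_steadyClassicalNS_ae_eq_of_veryWeak` — **very weak steady `L^p` solutions are
  smooth steady solutions** (`3 < p < ∞`, `ν = 1`): if `V ∈ L^p(ℝ³)` is weakly divergence free and
  `∫ (⟪V, (V·∇)φ⟫ + ⟪V, Δφ⟫) = 0` for every divergence-free `φ ∈ C_c^∞(ℝ³; ℝ³)`, then `V` agrees
  a.e. with the velocity `U` of a steady classical solution `(U, P)` (`IsSteadyClassicalNS 1 0 U P`).
  Proof = the tree's Kato route for the time-dependent problem read at `∂ₜ = 0`: the constant-in-time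
  field `u(t) = V` satisfies the very weak Navier–Stokes identity on the slab `(0, 2) × ℝ³`
  (`integral_veryWeakIntegrand_const_eq_zero`: the `∂ₜχ` term integrates to `0` in `t` by the
  fundamental theorem of calculus, the two spatial terms vanish slice by slice by hypothesis); hence
  it is a mild solution between all times (Fabes–Jones–Rivière,
  `VeryWeakLqMild.isMildNSSolutionBetween_of_veryWeak`), hence it has a classical representative
  `W` on some later time window (Kato 1984, `LpMildKato.exists_classical_representative`);
  `W(t) = V` a.e. for every `t` of the window and continuity of the slices make `W`
  time-independent, so `(W(t₀), Π(t₀))` is a steady classical solution (cf. Galdi 2011, Ch. X,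
  for the regularity theory of weak steady solutions; here the very weak `L^p` form, obtained
  from the time-dependent theory).
* `IsSteadyClassicalNS.isLerayProfile_zero` — a steady classical solution is a Leray profile with
  rate `a = 0` (the vocabulary of `SteadyNSLiouvilleLpDirichlet.lean`).
* `veryWeak_steadyNS_ae_eq_zero_of_weakGradL2Sq_lt_top` — **Chae's endgame in its provable
  range**: if moreover `p ≤ 9/2` and `V ∈ Ḣ¹` (a weak gradient in `L²`, `eWeakGradL2Sq V < ⊤`, the
  rendering used by the named fact), then `V = 0` a.e.: the weak gradient passes to the smooth
  representative (a.e. uniqueness of weak gradients), and `steadyNS_eq_zero_of_memLp_of_dirichlet`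
  (Galdi 2011, Thm. X.9.5 through the Sobolev embedding) applies. For `p > 9/2` that step is the
  open Liouville problem for steady D-solutions (`SteadyDSolutionLiouvilleProblem`); nothing is
  claimed there, and the endpoint `p = 3` (Kato's representative needs `p > 3`) is not treated.

Nothing is asserted about the named fact itself (its remaining step is the similarity-variable
weak limit) or about Navier–Stokes blow-up.

## References

* D. Chae, J. Funct. Anal. 258 (2010) 2865–2883, doi:10.1016/j.jfa.2010.02.006, proof of Thm. 1.4
  (p. 6 of the held text); = arXiv:0711.1113, §3, proof of Thm. 3.1. [Chae2010]
* G. P. Galdi, *An Introduction to the Mathematical Theory of the Navier–Stokes Equations.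
  Steady-State Problems*, 2nd ed., Springer 2011, Ch. X and Thm. X.9.5 (as cited by
  `SteadyNSLiouvilleLpDirichlet.lean`). [Galdi2011]
* T. Kato, Math. Z. 187 (1984) 471–480, Thm. 1. [Kato1984]
* E. B. Fabes, B. F. Jones, N. M. Rivière, Arch. Rational Mech. Anal. 45 (1972), Thm. 2.1.
  [FabesJonesRiviere1972]
-/

noncomputable section

open _root_.MeasureTheory Set Function Filter Metric TopologicalSpace InnerProductSpace
open scoped NNReal ENNReal _root_.Topology RealInnerProductSpace Laplacian ContDiff

namespace Literature.Analysis.FluidPDE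

/-! ### The constant-in-time field is a very weak solution on a slab -/

section Slab

variable {p : ℝ≥0} {V : EuclideanSpace ℝ (Fin 3) → EuclideanSpace ℝ (Fin 3)}

/-- The constant-in-time field built on `V ∈ L^p(ℝ³)`, `p ≥ 1`, is in `L^p` of every slab
`(0, S) × ℝ³` (finite time measure). [folklore] -/
private theorem memLp_uncurry_const_slab {S : ℝ} (hV : MemLp V (p : ℝ≥0∞) volume) :
    MemLp (uncurry fun _ : ℝ => V) (p : ℝ≥0∞)
      (volume.restrict (Ioo 0 S ×ˢ (univ : Set (EuclideanSpace ℝ (Fin 3))))) := by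
  rw [volume_restrict_prod_univ_eq_prod (Ioo 0 S)]
  exact hV.comp_snd (volume.restrict (Ioo 0 S))

/-- Local integrability of the constant-in-time field and of its square on the open slab, for
`V ∈ L^p(ℝ³)`, `p ≥ 2`. [folklore] -/
private theorem locallyIntegrableOn_const_slab {S : ℝ} (hp2 : 2 ≤ p)
    (hV : MemLp V (p : ℝ≥0∞) volume) :
    LocallyIntegrableOn (uncurry fun _ : ℝ => V)
        ((slab (EuclideanSpace ℝ (Fin 3)) (Ioo 0 S) isOpen_Ioo :
          Opens (ℝ × EuclideanSpace ℝ (Fin 3))) : Set (ℝ × EuclideanSpace ℝ (Fin 3))) volume ∧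
      LocallyIntegrableOn (fun z => ‖uncurry (fun _ : ℝ => V) z‖ ^ 2)
        ((slab (EuclideanSpace ℝ (Fin 3)) (Ioo 0 S) isOpen_Ioo :
          Opens (ℝ × EuclideanSpace ℝ (Fin 3))) : Set (ℝ × EuclideanSpace ℝ (Fin 3))) volume := by
  have huLr := memLp_uncurry_const_slab (S := S) hV
  have h1p : (1 : ℝ≥0∞) ≤ (p : ℝ≥0∞) := by
    have : (1 : ℝ≥0) ≤ p := le_trans (by norm_num) hp2
    exact_mod_cast this
  refine ⟨locallyIntegrableOn_slab_of_memLp huLr h1p, ?_⟩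
  have h := huLr.norm_rpow_div (2 : ℝ≥0∞)
  have h' : MemLp (fun z => ‖uncurry (fun _ : ℝ => V) z‖ ^ 2) ((p : ℝ≥0∞) / 2)
      (volume.restrict (Ioo 0 S ×ˢ (univ : Set (EuclideanSpace ℝ (Fin 3))))) := by
    refine h.congr_norm (huLr.1.norm.pow 2) (Eventually.of_forall fun z => ?_)
    simp only [ENNReal.toReal_ofNat, Real.rpow_two, norm_pow, norm_norm]
  refine locallyIntegrableOn_slab_of_memLp h' ?_
  have h2p : (2 : ℝ≥0∞) ≤ (p : ℝ≥0∞) := by exact_mod_cast hp2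
  exact (ENNReal.le_div_iff_mul_le (Or.inl two_ne_zero) (Or.inl ENNReal.ofNat_ne_top)).2
    (by rw [one_mul]; exact h2p)

/-- For a space–time test field on the slab `(0, S) × ℝ³` and a fixed point `x`, the time slice
`s ↦ χ s x` is continuous with compact support, and so is `s ↦ ∂ₜχ s x`. [folklore] -/
private theorem integrable_time_slice {S : ℝ} {F : Type*} [NormedAddCommGroup F] [NormedSpace ℝ F]
    {χ : ℝ → EuclideanSpace ℝ (Fin 3) → F}
    (hχ : IsSpaceTimeTestOn (slab (EuclideanSpace ℝ (Fin 3)) (Ioo 0 S) isOpen_Ioo) χ)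
    (x : EuclideanSpace ℝ (Fin 3)) : Integrable (fun s => χ s x) (volume : Measure ℝ) := by
  have hc : Continuous fun s => χ s x :=
    hχ.contDiff.continuous.comp (continuous_id.prodMk continuous_const)
  rcases lt_or_ge 0 S with hS | hS
  · obtain ⟨a, b, -, -, -, hab⟩ := hχ.exists_time_support_Ioo_slab hS
    refine hc.integrable_of_hasCompactSupport
      (HasCompactSupport.intro (K := Icc a b) isCompact_Icc fun s hs => ?_)
    rw [hab s hs]; rfl
  · have h0 : (fun s => χ s x) = fun _ => 0 := by
      funext s
      refine hχ.apply_eq_zero (t := s) (x := x) fun hmem => ?_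
      have : s ∈ Ioo 0 S := mem_slab.1 hmem
      exact absurd (this.1.trans this.2) (not_lt.2 hS)
    rw [h0]; exact integrable_zero _ _ _

/-- **The constant-in-time field is a very weak Navier–Stokes solution on every slab.** If
`V ∈ L^p(ℝ³)`, `p ≥ 2`, satisfies the stationary very weak identity
`∫ (⟪V, (V·∇)φ⟫ + ⟪V, Δφ⟫) = 0` for all divergence-free `φ ∈ C_c^∞(ℝ³; ℝ³)`, then `u(t) := V`
satisfies `∫∫ (⟪u, ∂ₜχ⟫ + ⟪u, (u·∇)χ⟫ + ⟪u, Δχ⟫) = 0` for every divergence-free space–time test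
field `χ` on `(0, S) × ℝ³`: the `∂ₜχ` term vanishes after integrating in `t` first (the
fundamental theorem of calculus for the compactly supported slice `s ↦ χ s x`), the other two
slice by slice
(a stationary solution is a time-independent solution of the evolution problem).
[cite: Chae2010, proof of Thm. 1.4, (1.27) (the stationary Navier–Stokes system satisfied by the profile, p. 6 of the journal text)] -/
theorem integral_veryWeakIntegrand_const_eq_zero {S : ℝ} (hp2 : 2 ≤ p)
    (hV : MemLp V (p : ℝ≥0∞) volume)
    (hsteady : ∀ φ : EuclideanSpace ℝ (Fin 3) → EuclideanSpace ℝ (Fin 3),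
      FunctionSpaces.IsTestFunctionOn (⊤ : Opens (EuclideanSpace ℝ (Fin 3))) φ →
      VectorCalculus.IsDivFree φ → ∫ x, (⟪V x, convect V φ x⟫ + ⟪V x, Δ φ x⟫) = 0)
    {χ : ℝ → EuclideanSpace ℝ (Fin 3) → EuclideanSpace ℝ (Fin 3)}
    (hχ : IsSpaceTimeTestOn (slab (EuclideanSpace ℝ (Fin 3)) (Ioo 0 S) isOpen_Ioo) χ)
    (hdivχ : ∀ t, VectorCalculus.IsDivFree (χ t)) :
    ∫ z in Ioo 0 S ×ˢ (univ : Set (EuclideanSpace ℝ (Fin 3))),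
      veryWeakIntegrand 1 (fun _ : ℝ => V) χ z = 0 := by
  obtain ⟨hu1, hu2⟩ := locallyIntegrableOn_const_slab (S := S) hp2 hV
  obtain ⟨IA, IB, IC⟩ := integrable_veryWeak_terms hu1 hu2 hχ 1
  set A : ℝ × EuclideanSpace ℝ (Fin 3) → ℝ := fun z => ⟪V z.2, timeDeriv χ z.1 z.2⟫ with hA
  set B : ℝ × EuclideanSpace ℝ (Fin 3) → ℝ := fun z => ⟪V z.2, convect V (χ z.1) z.2⟫ with hB
  set C : ℝ × EuclideanSpace ℝ (Fin 3) → ℝ := fun z => 1 * ⟪V z.2, Δ (χ z.1) z.2⟫ with hC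
  have hABC : ∀ z, veryWeakIntegrand 1 (fun _ : ℝ => V) χ z = A z + (B z + C z) := by
    intro z
    rw [veryWeakIntegrand_apply]
    simp only [hA, hB, hC]
    ring
  -- the integrand vanishes off the slab, so the set integral is a whole-space integral
  have hKQ := hχ.tsupport_subset
  have hzero : ∀ z, z ∉ Ioo 0 S ×ˢ (univ : Set (EuclideanSpace ℝ (Fin 3))) →
      veryWeakIntegrand 1 (fun _ : ℝ => V) χ z = 0 := by
    intro z hz
    have hz' : (z.1, z.2) ∉ tsupport (uncurry χ) := fun h => hz (by
      have := hKQ h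
      simpa [coe_slab] using this)
    have h1 : timeDeriv χ z.1 z.2 = 0 := IsSpaceTimeTestOn.timeDeriv_eq_zero_of_notMem hz'
    have h2 : fderiv ℝ (χ z.1) z.2 = 0 := IsSpaceTimeTestOn.fderiv_slice_eq_zero_of_notMem hz'
    have h3 : Δ (χ z.1) z.2 = 0 := laplacian_slice_eq_zero_of_notMem_tsupport hz'
    rw [hABC]
    simp only [hA, hB, hC, convect, h1, h2, h3, inner_zero_right, _root_.zero_apply, mul_zero,
      add_zero]
  rw [setIntegral_eq_integral_of_forall_compl_eq_zero hzero]
  simp_rw [hABC]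
  have IBC : Integrable (fun z => B z + C z) (volume : Measure (ℝ × EuclideanSpace ℝ (Fin 3))) :=
    IB.add IC
  have hsplit : ∫ z, (A z + (B z + C z)) = (∫ z, A z) + ∫ z, (B z + C z) := integral_add IA IBC
  rw [hsplit]
  -- ### the time term: integrate in `t` first
  have hAt : ∫ z, A z = 0 := by
    rw [Measure.volume_eq_prod, integral_prod_symm A (by rw [← Measure.volume_eq_prod]; exact IA)]
    refine integral_eq_zero_of_ae (Eventually.of_forall fun x => ?_)
    have hχ' := hχ.timeDeriv_isSpaceTimeTestOn
    have hint : Integrable (fun s => timeDeriv χ s x) (volume : Measure ℝ) :=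
      integrable_time_slice hχ' x
    show ∫ s, ⟪V x, timeDeriv χ s x⟫ = 0
    rw [integral_inner hint (V x)]
    have h0 : ∫ s, timeDeriv χ s x = 0 :=
      integral_eq_zero_of_hasDerivAt_of_integrable (fun s => hχ.hasDerivAt_time s x) hint
        (integrable_time_slice hχ x)
    rw [h0, inner_zero_right]
  -- ### the space terms: slice by slice
  have hBC : ∫ z, (B z + C z) = 0 := by
    rw [Measure.volume_eq_prod,
      integral_prod (fun z => B z + C z) (by rw [← Measure.volume_eq_prod]; exact IBC)]
    refine integral_eq_zero_of_ae (Eventually.of_forall fun t => ?_)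
    have hφ : FunctionSpaces.IsTestFunctionOn (⊤ : Opens (EuclideanSpace ℝ (Fin 3))) (χ t) :=
      { contDiff := hχ.contDiff_slice t
        hasCompactSupport := IsSpaceTimeTestOn.hasCompactSupport_slice hχ t
        tsupport_subset := fun _ _ => trivial }
    have h := hsteady (χ t) hφ (hdivχ t)
    show ∫ x, (⟪V x, convect V (χ t) x⟫ + 1 * ⟪V x, Δ (χ t) x⟫) = 0
    simpa only [one_mul] using h
  rw [hAt, hBC, add_zero]

end Slab

/-! ### Very weak steady `L^p` solutions are smooth steady solutions (`3 < p < ∞`) -/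

section Regularity

variable {p : ℝ≥0} {V : EuclideanSpace ℝ (Fin 3) → EuclideanSpace ℝ (Fin 3)}

/-- **A very weak steady `L^p` solution has a steady classical representative** — strongly
measurable version. For `V ∈ L^p(ℝ³)`, `3 < p < ∞`, strongly measurable, weakly divergence free,
with `∫ (⟪V, (V·∇)φ⟫ + ⟪V, Δφ⟫) = 0` for all divergence-free `φ ∈ C_c^∞(ℝ³; ℝ³)` (unit viscosity,
no force), there is a steady classical solution `(U, P)` of Navier–Stokes on `ℝ³` with `V = U`
a.e. Route: the constant-in-time field is very weak on `(0, 2) × ℝ³`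
(`integral_veryWeakIntegrand_const_eq_zero`), continuous and bounded in `L^p`, hence mild between
all times (`VeryWeakLqMild.isMildNSSolutionBetween_of_veryWeak`), hence classical on a later
window (`LpMildKato.exists_classical_representative`); the classical representative has every slice
a.e. equal to `V`, so its (continuous) slices coincide, its time derivative vanishes, and the
momentum equation at one time is the steady system. [cite: Chae2010, proof of Thm. 1.4 («V̄ is a stationary solution of the Navier–Stokes equations», (1.27), p. 6 of the journal text); Kato1984, Thm. 1; FabesJonesRiviere1972, Thm. 2.1] -/
theorem exists_steadyClassicalNS_ae_eq_of_veryWeak_of_stronglyMeasurable (hp3 : 3 < p)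
    (hV : MemLp V (p : ℝ≥0∞) volume) (hVm : StronglyMeasurable V) (hdiv : IsWeaklyDivFree V)
    (hsteady : ∀ φ : EuclideanSpace ℝ (Fin 3) → EuclideanSpace ℝ (Fin 3),
      FunctionSpaces.IsTestFunctionOn (⊤ : Opens (EuclideanSpace ℝ (Fin 3))) φ →
      VectorCalculus.IsDivFree φ → ∫ x, (⟪V x, convect V φ x⟫ + ⟪V x, Δ φ x⟫) = 0) :
    ∃ (U : EuclideanSpace ℝ (Fin 3) → EuclideanSpace ℝ (Fin 3)) (P : EuclideanSpace ℝ (Fin 3) → ℝ),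
      IsSteadyClassicalNS 1 0 U P ∧ V =ᵐ[volume] U := by
  set u : ℝ → EuclideanSpace ℝ (Fin 3) → EuclideanSpace ℝ (Fin 3) := fun _ => V with hu
  have hp2 : 2 < p := lt_trans (by norm_num) hp3
  have hp₃ : (3 : ℝ≥0∞) < (p : ℝ≥0∞) := by exact_mod_cast hp3
  have hptop : (p : ℝ≥0∞) < ⊤ := ENNReal.coe_lt_top
  have hpr : (p : ℝ≥0∞) = ENNReal.ofReal (p : ℝ) := (ENNReal.ofReal_coe_nnreal).symm
  have hr2 : (2 : ℝ) < (p : ℝ) := by exact_mod_cast hp2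
  -- measurability
  have hsm : StronglyMeasurable (uncurry u) := hVm.comp_measurable measurable_snd
  have hum : AEStronglyMeasurable (uncurry u)
      (volume.restrict (Ioo 0 2 ×ˢ (univ : Set (EuclideanSpace ℝ (Fin 3))))) :=
    hsm.aestronglyMeasurable
  -- continuity and boundedness in `L^p`
  have huc : ContinuousInLpOn (Ioo 0 2) (ENNReal.ofReal (p : ℝ)) u := by
    refine ⟨fun t _ => by rw [← hpr]; exact hV, fun t₀ _ => ?_⟩
    have : (fun t => eLpNorm (u t - u t₀) (ENNReal.ofReal (p : ℝ)) volume) = fun _ => 0 := by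
      funext t; simp [hu]
    rw [this]; exact tendsto_const_nhds
  set M : ℝ≥0 := (eLpNorm V p volume).toNNReal with hM
  have hMeq : (M : ℝ≥0∞) = eLpNorm V p volume := ENNReal.coe_toNNReal hV.2.ne
  have huM : ∀ τ ∈ Ioo (0 : ℝ) 2, eLpNorm (u τ) (p : ℝ≥0∞) volume ≤ M := fun τ _ => by
    rw [hMeq]
  have huM' : ∀ τ ∈ Ioo (0 : ℝ) 2, eLpNorm (u τ) (ENNReal.ofReal (p : ℝ)) volume ≤ M := fun τ hτ => by
    rw [← hpr]; exact huM τ hτ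
  have hdivu : ∀ τ ∈ Ioo (0 : ℝ) 2, IsWeaklyDivFree (u τ) := fun _ _ => hdiv
  -- very weak on the slab, hence mild between all times
  have hweak : ∀ χ : ℝ → EuclideanSpace ℝ (Fin 3) → EuclideanSpace ℝ (Fin 3),
      IsSpaceTimeTestOn (slab (EuclideanSpace ℝ (Fin 3)) (Ioo 0 2) isOpen_Ioo) χ →
      (∀ t, VectorCalculus.IsDivFree (χ t)) →
      ∫ z in Ioo 0 2 ×ˢ (univ : Set (EuclideanSpace ℝ (Fin 3))), veryWeakIntegrand 1 u χ z = 0 :=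
    fun χ hχ hdivχ => integral_veryWeakIntegrand_const_eq_zero hp2.le hV hsteady hχ hdivχ
  have hmild : ∀ ⦃s t : ℝ⦄, 0 < s → s ≤ t → t < 2 → IsMildNSSolutionBetween 1 0 u s t :=
    fun s t hs hst ht =>
      VeryWeakLqMild.isMildNSSolutionBetween_of_veryWeak one_pos hr2 hum huc huM' hdivu hweak hs hst ht
  -- Kato's classical representative on a window after `s₀ = 1`
  have hs₀ : (1 : ℝ) ∈ Ioo (0 : ℝ) 2 := ⟨one_pos, one_lt_two⟩
  obtain ⟨a, b, W, Pcl, -, hab, -, hW, hae⟩ :=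
    LpMildKato.exists_classical_representative hp₃ hptop hsm huM hdivu hmild hs₀
  -- the slices of `W` are continuous and a.e. equal to `V`, hence equal to each other
  set t₀ : ℝ := (a + b) / 2 with ht₀def
  have ht₀ : t₀ ∈ Ioo a b := ⟨by rw [ht₀def]; linarith, by rw [ht₀def]; linarith⟩
  have hWt : ∀ t ∈ Ioo a b, W t = W t₀ := by
    intro t ht
    have h1 : W t =ᵐ[volume] W t₀ := (hae t ht).trans (hae t₀ ht₀).symm
    exact Measure.eq_of_ae_eq h1 (hW.smooth_velocity.contDiff_slice ht).continuous
      (hW.smooth_velocity.contDiff_slice ht₀).continuous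
  -- the time derivative of `W` vanishes on the window
  have hdt : ∀ x, timeDerivWithin (Ioo a b) W t₀ x = 0 := by
    intro x
    rw [timeDerivWithin_of_mem_interior (by rwa [interior_Ioo]) x, timeDeriv_apply]
    have hev : (fun s => W s x) =ᶠ[𝓝 t₀] fun _ => W t₀ x := by
      filter_upwards [Ioo_mem_nhds ht₀.1 ht₀.2] with s hs
      rw [hWt s hs]
    rw [hev.deriv_eq, deriv_const]
  refine ⟨W t₀, Pcl t₀, ?_, (hae t₀ ht₀).symm⟩
  exact
    { smooth_velocity := hW.smooth_velocity.contDiff_slice ht₀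
      smooth_pressure := hW.smooth_pressure.contDiff_slice ht₀
      momentum := fun x => by
        have h := hW.momentum t₀ ht₀ x
        rw [hdt x, zero_add] at h
        simpa using h
      divFree := hW.divFree t₀ ht₀ }

/-- **A very weak steady `L^p` solution has a steady classical representative** (`3 < p < ∞`,
unit viscosity, no force): for `V ∈ L^p(ℝ³)` weakly divergence free with
`∫ (⟪V, (V·∇)φ⟫ + ⟪V, Δφ⟫) = 0` for all divergence-free `φ ∈ C_c^∞(ℝ³; ℝ³)`, there is a steady
classical solution `(U, P)` of Navier–Stokes on `ℝ³` (`IsSteadyClassicalNS 1 0 U P`: `U`, `P`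
smooth, `(U·∇)U = ΔU − ∇P`, `div U = 0`) with `V = U` a.e. (reduction to a strongly measurable
representative, against which all three hypotheses are stable, then
`exists_steadyClassicalNS_ae_eq_of_veryWeak_of_stronglyMeasurable`). [cite: Chae2010, proof of Thm. 1.4 («V̄ is a stationary solution of the Navier–Stokes equations», (1.27), p. 6 of the journal text); Kato1984, Thm. 1; FabesJonesRiviere1972, Thm. 2.1] -/
theorem exists_steadyClassicalNS_ae_eq_of_veryWeak (hp3 : 3 < p)
    (hV : MemLp V (p : ℝ≥0∞) volume) (hdiv : IsWeaklyDivFree V)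
    (hsteady : ∀ φ : EuclideanSpace ℝ (Fin 3) → EuclideanSpace ℝ (Fin 3),
      FunctionSpaces.IsTestFunctionOn (⊤ : Opens (EuclideanSpace ℝ (Fin 3))) φ →
      VectorCalculus.IsDivFree φ → ∫ x, (⟪V x, convect V φ x⟫ + ⟪V x, Δ φ x⟫) = 0) :
    ∃ (U : EuclideanSpace ℝ (Fin 3) → EuclideanSpace ℝ (Fin 3)) (P : EuclideanSpace ℝ (Fin 3) → ℝ),
      IsSteadyClassicalNS 1 0 U P ∧ V =ᵐ[volume] U := by
  set V' : EuclideanSpace ℝ (Fin 3) → EuclideanSpace ℝ (Fin 3) := hV.1.mk V with hV'def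
  have hVV' : V =ᵐ[volume] V' := hV.1.ae_eq_mk
  have hV'm : StronglyMeasurable V' := hV.1.stronglyMeasurable_mk
  have hV' : MemLp V' (p : ℝ≥0∞) volume := hV.ae_eq hVV'
  have hdiv' : IsWeaklyDivFree V' := by
    intro θ hθ
    rw [← hdiv θ hθ]
    refine integral_congr_ae ?_
    filter_upwards [hVV'] with x hx
    rw [hx]
  have hsteady' : ∀ φ : EuclideanSpace ℝ (Fin 3) → EuclideanSpace ℝ (Fin 3),
      FunctionSpaces.IsTestFunctionOn (⊤ : Opens (EuclideanSpace ℝ (Fin 3))) φ →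
      VectorCalculus.IsDivFree φ → ∫ x, (⟪V' x, convect V' φ x⟫ + ⟪V' x, Δ φ x⟫) = 0 := by
    intro φ hφ hdivφ
    rw [← hsteady φ hφ hdivφ]
    refine integral_congr_ae ?_
    filter_upwards [hVV'] with x hx
    simp only [convect, hx]
  obtain ⟨U, P, hUP, hae⟩ :=
    exists_steadyClassicalNS_ae_eq_of_veryWeak_of_stronglyMeasurable hp3 hV' hV'm hdiv' hsteady'
  exact ⟨U, P, hUP, hVV'.trans hae⟩

end Regularity

/-! ### The Liouville endgame (`3 < p ≤ 9/2`, `V ∈ Ḣ¹`) -/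

section Liouville

variable {E : Type*} [NormedAddCommGroup E] [InnerProductSpace ℝ E] [FiniteDimensional ℝ E]

/-- A steady classical solution of the unforced system is a Leray profile with rate `a = 0`
(`−νΔU + (U·∇)U + ∇P = 0`, `div U = 0`; the two vocabularies of `SteadyStrainedNS.lean` and
`SelfSimilar.lean` agree field by field). [cite: Chae2010, (1.27) (the stationary Navier–Stokes system = Leray's profile system at rate 0)] -/
theorem IsSteadyClassicalNS.isLerayProfile_zero {ν : ℝ} {U : E → E} {P : E → ℝ}
    (h : IsSteadyClassicalNS ν 0 U P) : IsLerayProfile ν 0 U P where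
  contDiff_velocity := h.smooth_velocity.of_le (by norm_cast)
  contDiff_pressure := h.smooth_pressure.of_le (by norm_cast)
  profile_eq y := by
    have hm := h.momentum y
    simp only [Pi.zero_apply, add_zero] at hm
    rw [hm, zero_smul, zero_smul]
    abel
  divFree := h.divFree

variable {p : ℝ≥0} {V : EuclideanSpace ℝ (Fin 3) → EuclideanSpace ℝ (Fin 3)}

/-- **Chae 2010, Thm. 1.4 — the last two printed steps, at the very weak level and in the
provable range.** Let `V ∈ L^p(ℝ³)`, `3 < p ≤ 9/2`, be weakly divergence free, satisfy the
stationary very weak Navier–Stokes identity `∫ (⟪V, (V·∇)φ⟫ + ⟪V, Δφ⟫) = 0` for every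
divergence-free `φ ∈ C_c^∞(ℝ³; ℝ³)` (unit viscosity), and lie in `Ḣ¹` in the sense of the named
fact `chae2010_typeII_asymptoticallySelfSimilar` (`eWeakGradL2Sq V < ⊤`: a weak gradient in `L²`).
Then `V = 0` a.e. ("`V̄` is a stationary solution … `V̄ ∈ Ḣ¹ ∩ L^p` … `∫|∇V̄|² = 0`, which implies
`V̄ = 0`"): `V` has a smooth steady representative `U` (`exists_steadyClassicalNS_ae_eq_of_veryWeak`),
the weak gradient of `V` is one of `U` and agrees a.e. with `∇U` (uniqueness of weak gradients),
so `∫ |∇U|² < ∞`, and `steadyNS_eq_zero_of_memLp_of_dirichlet` (Galdi's `L^{9/2}` criterion via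
the Sobolev embedding) gives `U = 0`. For `p > 9/2` the energy identity behind the printed step
is the open `SteadyDSolutionLiouvilleProblem`; not claimed. [cite: Chae2010, proof of Thm. 1.4 (last step, p. 6 of the journal text; arXiv:0711.1113 §3); Galdi2011, Thm. X.9.5] -/
theorem veryWeak_steadyNS_ae_eq_zero_of_weakGradL2Sq_lt_top (hp3 : 3 < p)
    (hp92 : (p : ℝ≥0∞) ≤ 9 / 2) (hV : MemLp V (p : ℝ≥0∞) volume) (hdiv : IsWeaklyDivFree V)
    (hsteady : ∀ φ : EuclideanSpace ℝ (Fin 3) → EuclideanSpace ℝ (Fin 3),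
      FunctionSpaces.IsTestFunctionOn (⊤ : Opens (EuclideanSpace ℝ (Fin 3))) φ →
      VectorCalculus.IsDivFree φ → ∫ x, (⟪V x, convect V φ x⟫ + ⟪V x, Δ φ x⟫) = 0)
    (hH1 : eWeakGradL2Sq V < ⊤) : V =ᵐ[volume] 0 := by
  obtain ⟨U, P, hUP, hVU⟩ := exists_steadyClassicalNS_ae_eq_of_veryWeak hp3 hV hdiv hsteady
  have hprof : IsLerayProfile 1 0 U P := hUP.isLerayProfile_zero
  have hU1 : ContDiff ℝ 1 U := hUP.smooth_velocity.of_le (by norm_cast)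
  have hUp : MemLp U (p : ℝ≥0∞) volume := hV.ae_eq hVU
  obtain ⟨G, hG⟩ := iInf_lt_iff.1 hH1
  obtain ⟨hWG, hGlt⟩ := iInf_lt_iff.1 hG
  have hWGU : HasWeakGradient U G := hWG.congr_ae hVU.symm
  have hDU : HasWeakGradient U (fderiv ℝ U) := hasWeakGradient_fderiv_of_contDiff hU1
  have haeG : fderiv ℝ U =ᵐ[volume] G := by
    have := FunctionSpaces.HasWeakFDerivOn.unique_holds hDU hWGU
    simpa [Measure.restrict_univ] using this
  have hD : (∫⁻ x, ENNReal.ofReal (frobeniusNormSq (fderiv ℝ U x))) < ⊤ := by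
    have e : (∫⁻ x, ENNReal.ofReal (frobeniusNormSq (fderiv ℝ U x))) =
        ∫⁻ x, ENNReal.ofReal (frobeniusNormSq (G x)) := by
      refine lintegral_congr_ae ?_
      filter_upwards [haeG] with x hx
      rw [hx]
    rw [e]; exact hGlt
  have h2p : (2 : ℝ≥0∞) ≤ (p : ℝ≥0∞) := by
    have : (2 : ℝ≥0) ≤ p := le_trans (by norm_num) hp3.le
    exact_mod_cast this
  have hU0 : U = 0 := steadyNS_eq_zero_of_memLp_of_dirichlet one_pos hprof h2p hp92 hUp hD
  rw [hU0] at hVU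
  exact hVU

end Liouville

end Literature.Analysis.FluidPDE

end
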